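import Summits.QuantumFields.YangMills.Theorems.FradkinShenkerFlowStrongPinningPoincareOfOneLinkLaplace
import Summits.QuantumFields.YangMills.Theorems.SusceptibilityToPoincare.Negative.Bottleneck

/-!
# `SusceptibilityToPoincare` — the strong-coupling window of the crux, unconditionally

Support for crux `stmt-QuantumFields-9441`
(`Summit.QuantumFields.YangMills.Theses.FradkinShenkerFlow.SusceptibilityToPoincare`, FS ⇒ UP). The crux's
CONCLUSION UP(r, β) — the uniform single-link heat-bath Poincaré inequality
`Var_{μ_{β,S}}(F) ≤ C ∑_ℓ ∫∫ (F U − F(U[ℓ ↦ g]))² dν_ℓ^U(g) dμ_{β,S}(U)` for every torus side `2S+1` and every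
bounded measurable `F`, `ν_ℓ^U = Haar.tilted(−β S_W(U[ℓ ↦ ·]))` — is proved OUTRIGHT, with `C = 1`, for every
compact group `G` carrying a lattice representation `r` and every coupling `0 ≤ β ≤ β₀(r)`,
`β₀(r) = 1 / (128 (√N + 1) (2√N + 1)²)` (`N = r.N`):

* `heatBathPoincare_smallBeta` — UP(r, β) with constant `1` on `[0, β₀(r)]`;
* `fs_imp_up_smallBeta` — hence the crux's implication FS(r, β) ⇒ UP(r, β) holds on `[0, β₀(r)]` for every
  compact simple `G` (the hypothesis FS is idle there);
* `no_bottleneck_smallBeta` — tightness for the negative side: on `[0, β₀(r)]` NO family of measurable events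
  with Wilson mass in `[δ, 1 − δ]` can have vanishing heat-bath boundary flux (by the landed bottleneck lemma
  `Negative.not_uniformHeatBathPoincare_of_bottleneck`), so every witness of the standing conditional
  refutations (`Negative/FalseOfTwistSectorInputs`, `Negative/TwistSectorSimplyConnected`) lives at `β > β₀(G, r)`.

Proof: the one-link heat baths of `μ_{β,S} = (Haar^{⊗E}).tilted(−β S_W)` satisfy the Kantorovich–Rubinstein
Dobrushin condition of the tree's abstract theorem `StrongPinningPoincare.HeatBath.variance_le_of_kr` with
column sums `≤ 1/2`: along the tilt interpolation between two backgrounds differing at one link `j`, the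
perturbation lemma `abs_integral_tilted_add_sub_le` needs only (a) the mixed Lipschitz bound of the Wilson action
`Lattice.abs_dd_wilsonAction_le` (column sums `≤ 64` in `d = 4`) and (b) a variance bound for Lipschitz
observables under the interpolating one-link laws — which at small `β` is the TRIVIAL one, `Var ψ ≤ (Lip ψ · diam)²`
for the Frobenius distance through `ρ` (diameter `≤ 2√N`), valid under any probability measure
(`integral_sq_sub_integral_le_sq`). No cluster expansion, curvature or simplicity of `G` is used. This is the
`s = 0` companion of the route's landed `StrongPinningPoincare_proof` (which covers pinning strengths
`s ≥ c(1+β)` instead of small `β`).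
-/

noncomputable section

open MeasureTheory Function Real Filter Topology
open scoped Matrix
open Literature.MathematicalPhysics.QuantumFieldTheory
open Summit.QuantumFields.YangMills.Theorems.StrongPinningPoincare

namespace Summit.QuantumFields.YangMills.Theorems.SusceptibilityToPoincare.StrongCoupling

/-- **Variance of an observable of bounded oscillation**: on a probability space, if `|ψ a − ψ b| ≤ K` for all
`a, b` (`ψ` bounded measurable), then `∫ (ψ − ∫ ψ)² ≤ K²`. [folklore] -/
theorem integral_sq_sub_integral_le_sq {S : Type*} [MeasurableSpace S] (ν : Measure S)
    [IsProbabilityMeasure ν] {ψ : S → ℝ} (hψm : Measurable ψ) (hψb : ∃ C, ∀ s, |ψ s| ≤ C)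
    {K : ℝ} (hosc : ∀ a b, |ψ a - ψ b| ≤ K) :
    ∫ s, (ψ s - ∫ s', ψ s' ∂ν) ^ 2 ∂ν ≤ K ^ 2 := by
  obtain ⟨C, hC⟩ := hψb
  have hψi : Integrable ψ ν := Integrable.of_bound hψm.aestronglyMeasurable C
    (ae_of_all _ fun s => by rw [Real.norm_eq_abs]; exact hC s)
  have hdev : ∀ s, |ψ s - ∫ s', ψ s' ∂ν| ≤ K := fun s => by
    have h1 : ∫ s', (ψ s - ψ s') ∂ν = ψ s - ∫ s', ψ s' ∂ν := by
      rw [integral_sub (integrable_const _) hψi]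
      simp
    rw [← h1]
    calc |∫ s', (ψ s - ψ s') ∂ν| ≤ ∫ s', |ψ s - ψ s'| ∂ν := abs_integral_le_integral_abs
      _ ≤ ∫ _s', K ∂ν := integral_mono_of_nonneg (ae_of_all _ fun _ => abs_nonneg _)
          (integrable_const K) (ae_of_all _ fun s' => hosc s s')
      _ = K := by simp
  calc ∫ s, (ψ s - ∫ s', ψ s' ∂ν) ^ 2 ∂ν ≤ ∫ _s, K ^ 2 ∂ν := by
        refine integral_mono_of_nonneg (ae_of_all _ fun _ => sq_nonneg _) (integrable_const _)
          (ae_of_all _ fun s => ?_)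
        calc (ψ s - ∫ s', ψ s' ∂ν) ^ 2 = |ψ s - ∫ s', ψ s' ∂ν| ^ 2 := (sq_abs _).symm
          _ ≤ K ^ 2 := pow_le_pow_left₀ (abs_nonneg _) (hdev s) 2
    _ = K ^ 2 := by simp

/-- **UP on the strong-coupling window, constant `1`.** For every compact group `G` with a lattice
representation `r` (continuous, faithful, unitary, degree `N`) there is
`β₀ = 1 / (128 (√N + 1) (2√N + 1)²) > 0` such that for all `0 ≤ β ≤ β₀`, every torus side `2S+1` and every
bounded measurable `F`,
`Var_{μ_{β,S}}(F) ≤ 1 · ∑_ℓ ∫∫ (F U − F(U[ℓ ↦ g]))² dν_ℓ^U(g) dμ_{β,S}(U)` with the one-link heat-bath laws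
`ν_ℓ^U = Haar.tilted (g' ↦ −β S_W(U[ℓ ↦ g']))` — verbatim the conclusion of
`FradkinShenkerFlow.SusceptibilityToPoincare` at `(G, r, β)`. Kantorovich–Rubinstein Dobrushin condition
(`HeatBath.variance_le_of_kr`, `κ₀ = 1/2`) from the perturbation lemma `abs_integral_tilted_add_sub_le`, the
mixed Lipschitz bound `Lattice.abs_dd_wilsonAction_le` and the trivial oscillation variance bound
`integral_sq_sub_integral_le_sq`. [folklore] -/
theorem heatBathPoincare_smallBeta :
    ∀ (G : Type) [Group G] [TopologicalSpace G] [IsTopologicalGroup G] [CompactSpace G] [MeasurableSpace G]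
      [BorelSpace G] (r : LatticeRep G), ∃ β₀ : ℝ, 0 < β₀ ∧ ∀ β : ℝ, 0 ≤ β → β ≤ β₀ → ∀ (S : ℕ)
      (F : GaugeConfig 4 (2 * S + 1) G → ℝ), Measurable F → (∃ M : ℝ, ∀ U, |F U| ≤ M) →
      ProbabilityTheory.variance F (wilsonMeasure (d := 4) (L := 2 * S + 1) r.ρ β) ≤
        1 * ∑ ℓ : Edge 4 (2 * S + 1), ∫ U, ∫ g, (F U - F (Function.update U ℓ g)) ^ 2
          ∂((haarProbability G).tilted (fun g' => -β * wilsonAction r.ρ (Function.update U ℓ g')))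
          ∂(wilsonMeasure (d := 4) (L := 2 * S + 1) r.ρ β) := by
  intro G _ _ _ _ _ _ r
  classical
  haveI : SecondCountableTopology G :=
    (r.continuous.isClosedEmbedding r.injective).isEmbedding.secondCountableTopology
  haveI : T2Space G := (r.continuous.isClosedEmbedding r.injective).isEmbedding.t2Space
  -- the diameter scale of the Frobenius distance and the threshold
  set Dm : ℝ := 2 * Real.sqrt r.N + 1 with hDm
  have hN0 : 0 ≤ Real.sqrt r.N := Real.sqrt_nonneg _
  have hDm0 : 0 < Dm := by rw [hDm]; linarith
  have hpos : 0 < 128 * (Real.sqrt r.N + 1) * Dm ^ 2 := by positivity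
  refine ⟨1 / (128 * (Real.sqrt r.N + 1) * Dm ^ 2), by positivity, ?_⟩
  intro β hβ hββ₀ S F hF hFb
  obtain ⟨M, hM⟩ := hFb
  have hkey : β * (128 * (Real.sqrt r.N + 1) * Dm ^ 2) ≤ 1 := (le_div_iff₀ hpos).1 hββ₀
  -- the log-density `V = -β S_W`
  set V : GaugeConfig 4 (2 * S + 1) G → ℝ := fun U => -β * wilsonAction r.ρ U with hV
  have hVm : Measurable V := (measurable_wilsonAction r.ρ r.continuous).const_mul _
  obtain ⟨B₁, hB₁⟩ := exists_abs_wilsonAction_le (d := 4) (L := 2 * S + 1) (G := G) r.ρ r.continuous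
  have hVb : ∀ U, |V U| ≤ |β| * B₁ := fun U => by
    simp only [hV, abs_mul, abs_neg]
    exact mul_le_mul_of_nonneg_left (hB₁ U) (abs_nonneg _)
  -- the Frobenius distance through `ρ`
  set dG : G → G → ℝ := fun a b => frobNorm (r.ρ a - r.ρ b) with hdG
  have hdc : Continuous fun p : G × G => dG p.1 p.2 :=
    Lattice.continuous_frobNorm.comp ((r.continuous.comp continuous_fst).sub
      (r.continuous.comp continuous_snd))
  have hd0 : ∀ e, dG e e = 0 := fun e => by simp [hdG, frobNorm_zero]
  have hdnn : ∀ e e', 0 ≤ dG e e' := fun e e' => frobNorm_nonneg _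
  have hdsymm : ∀ e e', dG e e' = dG e' e := fun e e' => frobNorm_sub_comm _ _
  have hdtri : ∀ a b c, dG a c ≤ dG a b + dG b c := fun a b c => frobNorm_sub_le _ _ _
  have hdsep : ∀ e e', dG e e' = 0 → e = e' := fun e e' h =>
    r.injective (sub_eq_zero.1 (Lattice.eq_zero_of_frobNorm_eq_zero h))
  have hdD : ∀ e e', dG e e' ≤ 2 * Real.sqrt r.N := fun e e' => by
    have h := frobNorm_sub_le_of_mem_unitaryGroup (r.mem_unitary e) (r.mem_unitary e')
    rwa [Fintype.card_fin] at h
  have hdDm : ∀ e e', dG e e' ≤ Dm := fun e e' => (hdD e e').trans (by rw [hDm]; linarith)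
  -- the interaction matrix: `c i j = β √N Dm² m(i,j)`, `m(i,j) = ∑ₚ nᵢ(p) nⱼ(p)`
  set m : Edge 4 (2 * S + 1) → Edge 4 (2 * S + 1) → ℝ := fun i j => ∑ p : Plaquette 4 (2 * S + 1),
    (∑ k : Fin 4, if (![(p.1, p.2.1.1), (p.1.shift p.2.1.1, p.2.1.2), (p.1.shift p.2.1.2, p.2.1.1),
      (p.1, p.2.1.2)] : Fin 4 → Edge 4 (2 * S + 1)) k = i then (1 : ℝ) else 0) *
    (∑ k : Fin 4, if (![(p.1, p.2.1.1), (p.1.shift p.2.1.1, p.2.1.2), (p.1.shift p.2.1.2, p.2.1.1),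
      (p.1, p.2.1.2)] : Fin 4 → Edge 4 (2 * S + 1)) k = j then (1 : ℝ) else 0) with hm
  have hm0 : ∀ i j, 0 ≤ m i j := fun i j => Finset.sum_nonneg fun p _ =>
    mul_nonneg (Finset.sum_nonneg fun k _ => by positivity) (Finset.sum_nonneg fun k _ => by positivity)
  have hmsum : ∀ j, ∑ i, m i j ≤ 64 := fun j =>
    (Lattice.sum_sum_slotCount_mul_le (d := 4) (L := 2 * S + 1) j).trans (by norm_num)
  set c : Edge 4 (2 * S + 1) → Edge 4 (2 * S + 1) → ℝ := fun i j =>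
    β * Real.sqrt r.N * Dm ^ 2 * m i j with hc
  have hθ : 0 ≤ β * Real.sqrt r.N * Dm ^ 2 := by positivity
  have hcsum : ∀ j, ∑ i ∈ Finset.univ.erase j, c i j ≤ 1 - 1 / 2 := fun j => by
    calc ∑ i ∈ Finset.univ.erase j, c i j ≤ ∑ i, c i j :=
          Finset.sum_le_sum_of_subset_of_nonneg (Finset.erase_subset _ _)
            fun i _ _ => mul_nonneg hθ (hm0 i j)
      _ = β * Real.sqrt r.N * Dm ^ 2 * ∑ i, m i j := by rw [Finset.mul_sum]
      _ ≤ β * Real.sqrt r.N * Dm ^ 2 * 64 := mul_le_mul_of_nonneg_left (hmsum j) hθ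
      _ ≤ 1 - 1 / 2 := by
          have hA : 0 ≤ β * Dm ^ 2 * 64 := by positivity
          have h1 : β * Real.sqrt r.N * Dm ^ 2 * 64 ≤ β * (Real.sqrt r.N + 1) * Dm ^ 2 * 64 := by
            nlinarith
          have h2 : β * (Real.sqrt r.N + 1) * Dm ^ 2 * 64 =
              β * (128 * (Real.sqrt r.N + 1) * Dm ^ 2) / 2 := by ring
          rw [h2] at h1
          linarith
  -- the one-site Kantorovich–Rubinstein condition
  have hKR : ∀ (i j : Edge 4 (2 * S + 1)), i ≠ j → ∀ (x : GaugeConfig 4 (2 * S + 1) G) (a : G)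
      (ψ : G → ℝ) (L Mψ : ℝ), Measurable ψ → (∀ e, |ψ e| ≤ Mψ) → 0 ≤ L →
      (∀ e e', |ψ e - ψ e'| ≤ L * dG e e') →
      |∫ e, ψ e ∂((haarProbability G).tilted fun e => V (update x i e)) -
        ∫ e, ψ e ∂((haarProbability G).tilted fun e => V (update (update x j a) i e))| ≤
        L * c i j * dG (x j) a := by
    intro i j hij x a ψ L Mψ hψm hψb hL0 hψL
    set f : G → ℝ := fun u => V (update x i u) with hf
    set w : G → ℝ := fun u => V (update (update x j a) i u) - V (update x i u) with hw
    have hfw : (fun u => f u + w u) = fun u => V (update (update x j a) i u) := by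
      funext u; simp only [hf, hw]; ring
    have hfm : Measurable f := hVm.comp (measurable_update x)
    have hfb : ∃ C, ∀ u, |f u| ≤ C := ⟨_, fun u => hVb _⟩
    have hwm : Measurable w := (hVm.comp (measurable_update _)).sub hfm
    have hwB : ∀ u, |w u| ≤ |β| * B₁ + |β| * B₁ := fun u =>
      (abs_sub _ _).trans (add_le_add (hVb _) (hVb _))
    -- the mixed Lipschitz bound for `w`
    set Dw : ℝ := β * Real.sqrt r.N * m i j * dG (x j) a with hDw
    have hDw0 : 0 ≤ Dw := by
      have := hm0 i j; have := hdnn (x j) a; positivity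
    have hwD : ∀ u u', |w u - w u'| ≤ Dw * dG u u' := fun u u' => by
      have hdd := Lattice.abs_dd_wilsonAction_le (d := 4) (L := 2 * S + 1) r.ρ r.mem_unitary x hij a u u'
      have e1 : w u - w u' = -β * (wilsonAction r.ρ (update (update x j a) i u) -
          wilsonAction r.ρ (update x i u) - wilsonAction r.ρ (update (update x j a) i u') +
          wilsonAction r.ρ (update x i u')) := by
        simp only [hw, hV]
        ring
      rw [e1, abs_mul, abs_neg, abs_of_nonneg hβ]
      calc β * _ ≤ β * (Real.sqrt r.N * frobNorm (r.ρ u - r.ρ u') * frobNorm (r.ρ (x j) - r.ρ a) *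
            m i j) := mul_le_mul_of_nonneg_left hdd hβ
        _ = Dw * dG u u' := by simp only [hDw, hdG]; ring
    -- the one-link variance bound along the interpolation: the trivial oscillation bound
    have hP : ∀ t ∈ Set.Icc (0 : ℝ) 1, ∀ (ψ' : G → ℝ) (M' : ℝ), Measurable ψ' →
        (∃ C, ∀ g, |ψ' g| ≤ C) → 0 ≤ M' → (∀ a b, |ψ' a - ψ' b| ≤ M' * dG a b) →
        ∫ g, (ψ' g - ∫ g', ψ' g' ∂((haarProbability G).tilted fun u => f u + t * w u)) ^ 2
          ∂((haarProbability G).tilted fun u => f u + t * w u) ≤ M' ^ 2 / (1 / Dm ^ 2) := by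
      intro t _ ψ' M' hψ'm hψ'b hM' hψ'L
      obtain ⟨Cf, hCf⟩ := hfb
      have hftm : Measurable fun u => f u + t * w u := hfm.add (hwm.const_mul t)
      have hexpi : Integrable (fun u => exp (f u + t * w u)) (haarProbability G) := by
        refine Integrable.of_bound hftm.exp.aestronglyMeasurable
          (exp (Cf + |t| * (|β| * B₁ + |β| * B₁))) (ae_of_all _ fun u => ?_)
        rw [Real.norm_eq_abs, abs_of_nonneg (exp_pos _).le, exp_le_exp]
        calc f u + t * w u ≤ |f u| + |t * w u| := (le_abs_self _).trans (abs_add_le _ _)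
          _ = |f u| + |t| * |w u| := by rw [abs_mul t (w u)]
          _ ≤ Cf + |t| * (|β| * B₁ + |β| * B₁) :=
              add_le_add (hCf u) (mul_le_mul_of_nonneg_left (hwB u) (abs_nonneg t))
      haveI : IsProbabilityMeasure ((haarProbability G).tilted fun u => f u + t * w u) :=
        isProbabilityMeasure_tilted hexpi
      have hosc : ∀ a b, |ψ' a - ψ' b| ≤ M' * Dm := fun a b =>
        (hψ'L a b).trans (mul_le_mul_of_nonneg_left (hdDm a b) hM')
      have h := integral_sq_sub_integral_le_sq ((haarProbability G).tilted fun u => f u + t * w u)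
        hψ'm hψ'b hosc
      have hrw : M' ^ 2 / (1 / Dm ^ 2) = (M' * Dm) ^ 2 := by
        rw [div_div_eq_mul_div, div_one, mul_pow]
      rw [hrw]
      exact h
    have hK : (0 : ℝ) < 1 / Dm ^ 2 := by positivity
    have hkr := abs_integral_tilted_add_sub_le (μ := haarProbability G) (r := dG) hfm hfb hwm hwB
      hψm ⟨Mψ, hψb⟩ hK hL0 hDw0 hψL hwD hP
    rw [hfw] at hkr
    rw [abs_sub_comm]
    refine hkr.trans (le_of_eq ?_)
    simp only [hDw, hc]
    field_simp
  -- the abstract theorem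
  have key := HeatBath.variance_le_of_kr (ι := Edge 4 (2 * S + 1)) (haarProbability G) hVm hVb dG
    hdc hd0 hdnn hdsymm hdtri hdsep hdD c (κ₀ := 1 / 2) (by norm_num) (by norm_num) hcsum hKR hF hM
  -- identification of the Wilson measure with the abstract Gibbs measure
  have hμ : wilsonMeasure (d := 4) (L := 2 * S + 1) r.ρ β =
      (Measure.pi fun _ : Edge 4 (2 * S + 1) => haarProbability G).tilted V :=
    Literature.MathematicalPhysics.QuantumLattice.wilsonMeasure_eq_tilted_pi r.ρ r.continuous β
  rw [hμ]
  norm_num at key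
  simpa [hV] using key

/-- **The crux's implication on the strong-coupling window.** For every compact simple `G`, every lattice
representation `r` and every `0 ≤ β ≤ β₀(r)` (`heatBathPoincare_smallBeta`), FS(r, β) ⇒ UP(r, β) — verbatim the
hypothesis and conclusion of `FradkinShenkerFlow.SusceptibilityToPoincare` at `(G, r, β)`; FS is idle on this
window (UP holds outright with `C = 1`). This is the part of the crux that is a theorem today; the content of the
crux is `β > β₀`. [folklore] -/
theorem fs_imp_up_smallBeta (G : Type) [Group G] [TopologicalSpace G] [IsTopologicalGroup G]
    [CompactSpace G] [MeasurableSpace G] [BorelSpace G] (_hG : IsCompactSimpleLieGroup G)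
    (r : LatticeRep G) :
    ∃ β₀ : ℝ, 0 < β₀ ∧ ∀ β : ℝ, 0 ≤ β → β ≤ β₀ →
      (∀ A B : YMSpecies G, ∃ χ : ℝ, ∀ S : ℕ, ∑ x ∈ Literature.Probability.LatticeModels.box 4 S,
        |ProbabilityTheory.covariance
          (fun U => A.F (Literature.MathematicalPhysics.QuantumLattice.torusLift (2 * S + 1) U))
          (fun U => B.F (Literature.MathematicalPhysics.QuantumLattice.configShift (-x)
            (Literature.MathematicalPhysics.QuantumLattice.torusLift (2 * S + 1) U)))
          (wilsonMeasure (d := 4) (L := 2 * S + 1) r.ρ β)| ≤ χ) →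
      ∃ C : ℝ, ∀ S : ℕ, ∀ F : GaugeConfig 4 (2 * S + 1) G → ℝ, Measurable F → (∃ M : ℝ, ∀ U, |F U| ≤ M) →
        ProbabilityTheory.variance F (wilsonMeasure (d := 4) (L := 2 * S + 1) r.ρ β) ≤
          C * ∑ ℓ : Edge 4 (2 * S + 1), ∫ U, ∫ g, (F U - F (Function.update U ℓ g)) ^ 2
            ∂((haarProbability G).tilted (fun g' => -β * wilsonAction r.ρ (Function.update U ℓ g')))
            ∂(wilsonMeasure (d := 4) (L := 2 * S + 1) r.ρ β) := by
  obtain ⟨β₀, hβ₀, h⟩ := heatBathPoincare_smallBeta G r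
  exact ⟨β₀, hβ₀, fun β hβ hββ₀ _ => ⟨1, h β hβ hββ₀⟩⟩

/-- **Tightness for the negative side: no bottleneck on the strong-coupling window.** For every compact `G` with
a lattice representation `r` and every `0 ≤ β ≤ β₀(r)` (`heatBathPoincare_smallBeta`), there is NO family of
measurable events `A S ⊆ G^{E(2S+1)}` with Wilson mass in `[δ, 1 − δ]` (`δ > 0`) whose single-link heat-bath
boundary flux tends to `0` as `S → ∞` — the shape of every known obstruction to UP (twist sectors, centre sectors,
phase coexistence) and exactly conjuncts (ii) ∧ (iii) of `Literature.…TwistSectorInputs` / of the SU(2) twist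
inputs of `Negative/TwistSectorSimplyConnected`. Hence every witness of those conditional refutations of the crux
has `β > β₀(G, r)`. From `heatBathPoincare_smallBeta` and the landed bottleneck lemma
`Negative.not_uniformHeatBathPoincare_of_bottleneck`. [folklore] -/
theorem no_bottleneck_smallBeta (G : Type) [Group G] [TopologicalSpace G] [IsTopologicalGroup G]
    [CompactSpace G] [MeasurableSpace G] [BorelSpace G] (r : LatticeRep G) :
    ∃ β₀ : ℝ, 0 < β₀ ∧ ∀ β : ℝ, 0 ≤ β → β ≤ β₀ → ∀ δ : ℝ, 0 < δ →
      ∀ A : ∀ S : ℕ, Set (GaugeConfig 4 (2 * S + 1) G), (∀ S, MeasurableSet (A S)) →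
      (∀ S, δ ≤ (wilsonMeasure (d := 4) (L := 2 * S + 1) r.ρ β).real (A S) ∧
        (wilsonMeasure (d := 4) (L := 2 * S + 1) r.ρ β).real (A S) ≤ 1 - δ) →
      ¬ Tendsto (fun S : ℕ => ∑ ℓ : Edge 4 (2 * S + 1), ∫ U, ∫ g,
          ((A S).indicator (1 : GaugeConfig 4 (2 * S + 1) G → ℝ) U -
            (A S).indicator 1 (Function.update U ℓ g)) ^ 2
          ∂((haarProbability G).tilted (fun g' => -β * wilsonAction r.ρ (Function.update U ℓ g')))
          ∂(wilsonMeasure (d := 4) (L := 2 * S + 1) r.ρ β)) atTop (𝓝 0) := by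
  obtain ⟨β₀, hβ₀, h⟩ := heatBathPoincare_smallBeta G r
  refine ⟨β₀, hβ₀, fun β hβ hββ₀ δ hδ A hmeas hmass hflux => ?_⟩
  exact Negative.not_uniformHeatBathPoincare_of_bottleneck r β hδ A hmeas hmass hflux ⟨1, h β hβ hββ₀⟩

end Summit.QuantumFields.YangMills.Theorems.SusceptibilityToPoincare.StrongCoupling

end
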